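import Mathlib.AlgebraicGeometry.RelativeGluing
import Mathlib.AlgebraicGeometry.Sites.SmallAffineZariski
import Literature.AlgebraicGeometry.Resolution.ResolutionOfSingularities
import Literature.AlgebraicGeometry.Resolution.ResolutionGlue
import Literature.AlgebraicGeometry.Resolution.PrincipalizationToResolution
import Literature.AlgebraicGeometry.Resolution.NormalizationInExtension
import Summits.ResolutionOfSingularities.ResolutionOfSingularities.Theses.PAlteration
import Summits.ResolutionOfSingularities.ResolutionOfSingularities.Theorems.PAlterationPicoverOfDegP
import Summits.ResolutionOfSingularities.ResolutionOfSingularities.Theorems.PAlterationPicoverDegPOfPicover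
import HarnessLib

/-!
# Crux `Picover` (stmt-ResolutionOfSingularities-0554): resolutions glue along locally directed
open covers — the crux from FUNCTORIAL local resolutions

Route `ResolutionOfSingularities/pAlteration`, crux `Picover` (rank 2), support file (line lead a2,
2026-08-16). The tree already proves (`Picover.IffDegP.picover_iff_picoverDegP`) that the crux is
equivalent to its degree-`p` residue — resolve `normalizationIn W L` for `W` regular integral
separated of finite type over `k` and `L/K(W)` purely inseparable of degree `p` — and
(`Picover.AffineDegP.picoverLocalModel_iff_affineDegP`, `Picover.AffineOfLocalModel…`) that the
rank-5 item `PicoverLocalModel` is the same residue for AFFINE `W`. What separates rank 2 from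
rank 5 is therefore exactly the passage affine → separated, i.e. the gluing of local resolutions.

This file supplies the gluing half of that passage, as known mathematics on Mathlib's scheme
library (Stacks 01LH, relative gluing; Mathlib `Scheme.Cover.RelativeGluingData`):

* `isBirational_of_arrow_iso`, `isResolution_of_arrow_iso` — transport along isomorphisms of arrows;
* `dense_of_iSup_eq_top` — density is local on an open cover;
* `isBirational_of_iSup_eq_top` — **birationality is Zariski-local on the target**;
* `isResolution_of_iSup_eq_top`, `isResolution_iff_of_iSup_eq_top` — **being a resolution of
  singularities is Zariski-local on the target** (properness is local on the target, regularity
  is local on the source);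
* `isResolution_toBase`, `hasResolution_of_relativeGluingData` — **compatible (equifibered) local
  resolutions over a locally directed open cover glue to a resolution** of the whole scheme;
* `picover_of_functorialLocalResolutions` — the crux BY NAME from resolutions of the pieces
  `W^L ×_W U` over the affine opens `U ⊆ W` that are FUNCTORIAL in `U` (pull back along
  inclusions of affine opens), via `Picover.OfDegP.picover_of_picoverDegP`;
* `exists_relativeGluingData_of_isResolution`, `hasResolution_iff_exists_relativeGluingData` —
  conversely a resolution restricts to such data over any locally directed open cover;
* `functorialLocalResolutions_of_picover`, `picover_iff_functorialLocalResolutions` and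
  `picover_iff_functorialLocalResolutions_basicOpen` — the reformulation is an EQUIVALENCE, also
  with functoriality required only along basic-open inclusions `D(g) ⊆ U` (Mathlib's small affine
  Zariski site): the research content of the crux beyond rank 5 is precisely the FUNCTORIALITY
  under principal localisation `R → R[1/g]` of resolutions of the affine `p`-th-root models.

No new definitions. [folklore; cite: StacksProject, Tag 01LH]
-/

noncomputable section

set_option linter.dupNamespace false -- mandated namespace of this single-conjunct summit

open CategoryTheory CategoryTheory.Limits AlgebraicGeometry TopologicalSpace Topology
open Literature.AlgebraicGeometry.Resolution

namespace Summit.ResolutionOfSingularities.ResolutionOfSingularities.Theorems.Picover.ResolutionGluing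

universe u

variable {Y X : Scheme.{u}}

/-! ## Transport along isomorphisms of arrows -/

/-- An isomorphism is birational. [folklore] -/
theorem isBirational_of_isIso (e : Y ⟶ X) [IsIso e] : IsBirational e :=
  ⟨⊤, by simp, by simp, inferInstance⟩

/-- Birationality is invariant under isomorphisms of arrows. [folklore] -/
theorem isBirational_of_arrow_iso {Y' X' : Scheme.{u}} {π : Y ⟶ X} {π' : Y' ⟶ X'}
    (e : Arrow.mk π ≅ Arrow.mk π') (h : IsBirational π) : IsBirational π' := by
  have h₁ : IsBirational (e.inv.left : Y' ⟶ Y) :=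
    @isBirational_of_isIso _ _ e.inv.left (Arrow.isIso_left e.inv)
  have h₂ : IsBirational (e.hom.right : X ⟶ X') :=
    @isBirational_of_isIso _ _ e.hom.right (Arrow.isIso_right e.hom)
  rw [Arrow.iso_w' e]
  exact h₁.comp (h.comp h₂)

/-- Being a resolution is invariant under isomorphisms of arrows. [folklore] -/
theorem isResolution_of_arrow_iso {Y' X' : Scheme.{u}} {π : Y ⟶ X} {π' : Y' ⟶ X'}
    (e : Arrow.mk π ≅ Arrow.mk π') (h : IsResolution π) : IsResolution π' where
  isProper := by
    haveI := h.isProper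
    exact ((MorphismProperty.arrow_mk_iso_iff @IsProper e).mp h.isProper)
  isBirational := isBirational_of_arrow_iso e h.isBirational
  isRegular := @Scheme.IsRegular.of_iso _ _ e.hom.left (Arrow.isIso_left e.hom) h.isRegular

/-! ## Density and birationality are local on the target -/

/-- A subset of a scheme whose trace on every member of an open cover is dense is dense.
[folklore] -/
theorem dense_of_iSup_eq_top {ι : Type*} (U : ι → X.Opens) (hU : iSup U = ⊤) (s : Set X)
    (h : ∀ i, Dense ((Subtype.val : U i → X) ⁻¹' s)) : Dense s := by
  intro x
  have hx : x ∈ iSup U := by rw [hU]; trivial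
  obtain ⟨i, hi⟩ := Opens.mem_iSup.mp hx
  have h1 := (h i) ⟨x, hi⟩
  rw [IsEmbedding.subtypeVal.closure_eq_preimage_closure_image] at h1
  exact closure_mono (Set.image_preimage_subset _ _) h1

/-- The points of `f ∣_ U` lie over those of `f`. [folklore] -/
theorem morphismRestrict_apply_val (f : Y ⟶ X) (U : X.Opens) (y : ↥(f ⁻¹ᵁ U)) :
    ((f ∣_ U) y).1 = f y.1 :=
  morphismRestrict_base_coe f U y

/-- **Birationality is Zariski-local on the target**: if `π ∣_ Uᵢ` is birational for an open cover
`(Uᵢ)` of `X`, then `π` is birational — the dense opens over which the restrictions are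
isomorphisms assemble to a dense open of `X` with dense preimage over which `π` is an isomorphism.
[folklore] -/
theorem isBirational_of_iSup_eq_top (π : Y ⟶ X) {ι : Type*} (U : ι → X.Opens) (hU : iSup U = ⊤)
    (h : ∀ i, IsBirational (π ∣_ U i)) : IsBirational π := by
  choose V hVd hVpre hViso using h
  let V' : ι → X.Opens := fun i => (U i).ι ''ᵁ V i
  have hV'iso : ∀ i, IsIso (π ∣_ V' i) := fun i =>
    ((MorphismProperty.isomorphisms Scheme).arrow_mk_iso_iff
      (morphismRestrictRestrict π (U i) (V i))).mp (hViso i)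
  refine ⟨⨆ i, V' i, ?_, ?_, isIso_morphismRestrict_iSup π V' hV'iso⟩
  · refine dense_of_iSup_eq_top U hU _ fun i => (hVd i).mono fun x hx => ?_
    change x.1 ∈ ((⨆ i, V' i : X.Opens) : Set X)
    exact Opens.mem_iSup.mpr ⟨i, ⟨x, hx, rfl⟩⟩
  · refine dense_of_iSup_eq_top (fun i => π ⁻¹ᵁ U i) (π.iSup_preimage_eq_top hU) _
      fun i => (hVpre i).mono fun y hy => ?_
    change π y.1 ∈ ((⨆ i, V' i : X.Opens) : Set X)
    refine Opens.mem_iSup.mpr ⟨i, ⟨(π ∣_ U i) y, hy, ?_⟩⟩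
    exact morphismRestrict_apply_val π (U i) y

/-! ## Being a resolution is local on the target -/

/-- **Resolutions are Zariski-local on the target**: if `π ∣_ Uᵢ` is a resolution of `Uᵢ` for an
open cover `(Uᵢ)` of `X`, then `π` is a resolution of `X` (properness is local on the target —
Mathlib; birationality by `isBirational_of_iSup_eq_top`; the source is covered by the regular
open subschemes `π⁻¹ Uᵢ`). [folklore] -/
theorem isResolution_of_iSup_eq_top (π : Y ⟶ X) {ι : Type*} (U : ι → X.Opens) (hU : iSup U = ⊤)
    (h : ∀ i, IsResolution (π ∣_ U i)) : IsResolution π where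
  isProper := IsZariskiLocalAtTarget.of_iSup_eq_top U hU fun i => (h i).isProper
  isBirational := isBirational_of_iSup_eq_top π U hU fun i => (h i).isBirational
  isRegular := by
    refine Scheme.IsRegular.of_forall_exists_isOpenImmersion fun y => ?_
    have hy : π y ∈ iSup U := by rw [hU]; trivial
    obtain ⟨i, hi⟩ := Opens.mem_iSup.mp hy
    exact ⟨_, (π ⁻¹ᵁ U i).ι, inferInstance, by simpa using hi, (h i).isRegular⟩

/-- Resolutions restrict over opens of the target. [folklore] -/
theorem isResolution_morphismRestrict {π : Y ⟶ X} (h : IsResolution π) (U : X.Opens) :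
    IsResolution (π ∣_ U) where
  isProper := by
    haveI := h.isProper
    infer_instance
  isBirational := h.isBirational.morphismRestrict U
  isRegular := h.isRegular.of_isOpenImmersion (π ⁻¹ᵁ U).ι

/-- Being a resolution is local on the target (iff form). [folklore] -/
theorem isResolution_iff_of_iSup_eq_top (π : Y ⟶ X) {ι : Type*} (U : ι → X.Opens)
    (hU : iSup U = ⊤) : IsResolution π ↔ ∀ i, IsResolution (π ∣_ U i) :=
  ⟨fun h i => isResolution_morphismRestrict h (U i), isResolution_of_iSup_eq_top π U hU⟩

/-! ## Relative gluing of resolutions (Stacks 01LH) -/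

section Glue

variable {S : Scheme.{u}} {𝒰 : S.OpenCover} [Category 𝒰.I₀] [𝒰.LocallyDirected]
  [Small.{u} 𝒰.I₀] [Quiver.IsThin 𝒰.I₀] (d : 𝒰.RelativeGluingData)

/-- The piece `Xᵢ → Uᵢ` of a relative gluing datum is, as an arrow, the restriction of the glued
morphism `X → S` over the open `Uᵢ ⊆ S` (the pullback square of Stacks 01LH (1)). [cite:
StacksProject, Tag 01LH] -/
theorem nonempty_arrowIso_restrict (i : 𝒰.I₀) :
    Nonempty (Arrow.mk (d.natTrans.app i) ≅ Arrow.mk (d.toBase ∣_ (𝒰.f i).opensRange)) :=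
  ⟨Arrow.isoMk' (d.natTrans.app i) (pullback.snd d.toBase (𝒰.f i))
      (d.isPullback_natTrans_ι_toBase i).flip.isoPullback (Iso.refl _)
      (((d.isPullback_natTrans_ι_toBase i).flip.isoPullback_hom_snd).trans
        (Category.comp_id _).symm) ≪≫
    (morphismRestrictOpensRange d.toBase (𝒰.f i)).symm⟩

/-- **Compatible local resolutions glue** (relative gluing, Stacks 01LH): if every piece
`Xᵢ → Uᵢ` of a relative gluing datum over a locally directed open cover `(Uᵢ)` of `S` is a
resolution of singularities of `Uᵢ`, the glued morphism `X → S` is a resolution of `S`.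
[cite: StacksProject, Tag 01LH] -/
theorem isResolution_toBase (h : ∀ i, IsResolution (d.natTrans.app i)) :
    IsResolution d.toBase :=
  isResolution_of_iSup_eq_top d.toBase (fun i => (𝒰.f i).opensRange) 𝒰.iSup_opensRange
    fun i => isResolution_of_arrow_iso (nonempty_arrowIso_restrict d i).some (h i)

/-- A scheme covered by a locally directed open cover carrying compatible local resolutions has a
resolution of singularities. [cite: StacksProject, Tag 01LH] -/
theorem hasResolution_of_relativeGluingData (h : ∀ i, IsResolution (d.natTrans.app i)) :
    Scheme.HasResolution S :=
  ⟨_, d.toBase, isResolution_toBase d h⟩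

/-! ### Converse: a morphism restricts to a relative gluing datum over any locally directed cover -/

omit [Small.{u} 𝒰.I₀] [Quiver.IsThin 𝒰.I₀] in
/-- **Restriction of a morphism to a locally directed open cover is a relative gluing datum**, and
if the morphism is a resolution so are all the pieces: for `π : T → S` the base changes
`T ×_S Uᵢ → Uᵢ` along the cover, with the transition maps induced by those of the cover, form an
equifibered family (pasting of pullback squares); each piece is the restriction `π ∣_ Uᵢ` as an
arrow (`morphismRestrictOpensRange`), a resolution when `π` is (`isResolution_morphismRestrict`).
[folklore; cite: StacksProject, Tag 01LH] -/
theorem exists_relativeGluingData_of_isResolution {T : Scheme.{u}} (π : T ⟶ S)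
    (hπ : IsResolution π) :
    ∃ d : 𝒰.RelativeGluingData, ∀ i, IsResolution (d.natTrans.app i) := by
  -- the transition maps `T ×_S Uᵢ → T ×_S Uⱼ` induced by `Uᵢ → Uⱼ`
  let m : ∀ {i j : 𝒰.I₀} (_ : i ⟶ j), pullback π (𝒰.f i) ⟶ pullback π (𝒰.f j) :=
    fun {i j} hij => pullback.lift (pullback.fst π (𝒰.f i)) (pullback.snd π (𝒰.f i) ≫ 𝒰.trans hij)
      (by rw [Category.assoc, Scheme.Cover.trans_map]; exact pullback.condition)
  have m_fst : ∀ {i j : 𝒰.I₀} (hij : i ⟶ j), m hij ≫ pullback.fst π (𝒰.f j) = pullback.fst π (𝒰.f i) :=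
    fun hij => pullback.lift_fst _ _ _
  have m_snd : ∀ {i j : 𝒰.I₀} (hij : i ⟶ j),
      m hij ≫ pullback.snd π (𝒰.f j) = pullback.snd π (𝒰.f i) ≫ 𝒰.trans hij :=
    fun hij => pullback.lift_snd _ _ _
  let F : 𝒰.I₀ ⥤ Scheme.{u} :=
    { obj := fun i => pullback π (𝒰.f i)
      map := fun hij => m hij
      map_id := fun i => by
        refine pullback.hom_ext ?_ ?_
        · rw [m_fst, Category.id_comp]
        · rw [m_snd, Scheme.Cover.trans_id, Category.id_comp, Category.comp_id]
      map_comp := fun hij hjl => by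
        refine pullback.hom_ext ?_ ?_
        · rw [m_fst, Category.assoc, m_fst, m_fst]
        · rw [m_snd, Category.assoc, m_snd, ← Category.assoc, m_snd, Category.assoc,
            Scheme.Cover.trans_comp] }
  let α : F ⟶ 𝒰.functorOfLocallyDirected :=
    { app := fun i => pullback.snd π (𝒰.f i)
      naturality := fun _ _ hij => m_snd hij }
  -- the squares `T ×_S Uᵢ → Uᵢ` over `T ×_S Uⱼ → Uⱼ` are pullbacks (pasting)
  have key : ∀ {i j : 𝒰.I₀} (hij : i ⟶ j),
      IsPullback (m hij) (pullback.snd π (𝒰.f i)) (pullback.snd π (𝒰.f j)) (𝒰.trans hij) := by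
    intro i j hij
    have u : IsPullback (m hij ≫ pullback.fst π (𝒰.f j)) (pullback.snd π (𝒰.f i)) π
        (𝒰.trans hij ≫ 𝒰.f j) :=
      (IsPullback.of_hasPullback π (𝒰.f i)).of_iso (Iso.refl _) (Iso.refl _) (Iso.refl _)
        (Iso.refl _) (by simp only [Iso.refl_hom, Category.comp_id, Category.id_comp, m_fst])
        (by simp only [Iso.refl_hom, Category.comp_id, Category.id_comp])
        (by simp only [Iso.refl_hom, Category.comp_id, Category.id_comp])
        (by simp only [Iso.refl_hom, Category.comp_id, Category.id_comp, Scheme.Cover.trans_map])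
    exact IsPullback.of_right u (m_snd hij) (IsPullback.of_hasPullback π (𝒰.f j))
  refine ⟨⟨F, α, fun i j hij => key hij⟩, fun i => ?_⟩
  exact isResolution_of_arrow_iso (morphismRestrictOpensRange π (𝒰.f i))
    (isResolution_morphismRestrict hπ _)

/-- **A scheme has a resolution iff some (any) locally directed open cover carries a relative
gluing datum of resolutions** (glue with `hasResolution_of_relativeGluingData`; restrict with
`exists_relativeGluingData_of_isResolution`). [folklore; cite: StacksProject, Tag 01LH] -/
theorem hasResolution_iff_exists_relativeGluingData :
    Scheme.HasResolution S ↔ ∃ d : 𝒰.RelativeGluingData, ∀ i, IsResolution (d.natTrans.app i) :=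
  ⟨fun ⟨_, π, hπ⟩ => exists_relativeGluingData_of_isResolution π hπ,
    fun ⟨d, hd⟩ => hasResolution_of_relativeGluingData d hd⟩

end Glue

/-! ## The crux from functorial local resolutions over the affine charts of the regular base -/

/-- **`Picover` from FUNCTORIAL local resolutions.** Suppose that for every prime `p`, field `k`
of characteristic `p`, regular integral separated `W` of finite type over `k` and purely
inseparable `L/K(W)` of degree `p`, the pieces `X_U := W^L ×_W U` of `X = W^L = normalizationIn W L`
over the affine opens `U ⊆ W` carry resolutions `Y_U → X_U` that are FUNCTORIAL in `U`: they form
a relative gluing datum over the (locally directed) cover of `X` pulled back from the cover of `W`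
by all its affine opens — i.e. for `U ≤ V` the resolution of `X_U` is the pull-back of that of
`X_V`. Then the crux `Picover` holds: the data glue to a resolution of `W^L`
(`hasResolution_of_relativeGluingData`), which is the degree-`p` residue, and the residue gives
the crux (`Picover.OfDegP.picover_of_picoverDegP`). Each `X_U` is the affine `p`-th-root model of
the rank-5 item `PicoverLocalModel` (`Picover.AffineDegP…`), so this isolates what rank 2 asks
beyond rank 5: canonicity of the local resolutions under restriction to smaller affine charts.
[folklore] -/
theorem picover_of_functorialLocalResolutions
    (H : ∀ (p : ℕ), p.Prime → ∀ (k : Type) [Field k] [CharP k p] (W : Scheme.{0}) [IsIntegral W]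
      (f : W ⟶ Spec (.of k)) (L : Type) [Field L] [Algebra W.functionField L],
      IsSeparated f → LocallyOfFiniteType f → QuasiCompact f → Scheme.IsRegular W →
      IsPurelyInseparable W.functionField L → Module.finrank W.functionField L = p →
      ∃ d : Scheme.Cover.RelativeGluingData
        (W.directedAffineCover.pullback₁ (normalizationInι W L)),
        ∀ U, IsResolution (d.natTrans.app U)) :
    Summit.ResolutionOfSingularities.ResolutionOfSingularities.Theses.PAlteration.Picover :=
  OfDegP.picover_of_picoverDegP fun p hp k _ _ W _ f L _ _ hs hl hq hreg hpi hdeg => by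
    obtain ⟨d, hd⟩ := H p hp k W f L hs hl hq hreg hpi hdeg
    haveI : Quiver.IsThin (W.directedAffineCover.pullback₁ (normalizationInι W L)).I₀ :=
      inferInstanceAs (Quiver.IsThin W.directedAffineCover.I₀)
    exact hasResolution_of_relativeGluingData d hd

/-- **Converse: `Picover` gives functorial local resolutions** — restrict a resolution of `W^L`
(which exists by the residue form of the crux, `Picover.DegPOfPicover.picoverDegP_of_picover`) to
the cover pulled back from the affine opens of `W` (`exists_relativeGluingData_of_isResolution`).
[folklore] -/
theorem functorialLocalResolutions_of_picover
    (h : Summit.ResolutionOfSingularities.ResolutionOfSingularities.Theses.PAlteration.Picover) :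
    ∀ (p : ℕ), p.Prime → ∀ (k : Type) [Field k] [CharP k p] (W : Scheme.{0}) [IsIntegral W]
      (f : W ⟶ Spec (.of k)) (L : Type) [Field L] [Algebra W.functionField L],
      IsSeparated f → LocallyOfFiniteType f → QuasiCompact f → Scheme.IsRegular W →
      IsPurelyInseparable W.functionField L → Module.finrank W.functionField L = p →
      ∃ d : Scheme.Cover.RelativeGluingData
        (W.directedAffineCover.pullback₁ (normalizationInι W L)),
        ∀ U, IsResolution (d.natTrans.app U) := by
  intro p hp k _ _ W _ f L _ _ hs hl hq hreg hpi hdeg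
  obtain ⟨T, π, hπ⟩ := DegPOfPicover.picoverDegP_of_picover h p hp k W f L hs hl hq hreg hpi hdeg
  exact exists_relativeGluingData_of_isResolution π hπ

/-- **`Picover` ⟺ functorial local resolutions of the `p`-th-root charts.** The crux holds if and
only if, for every regular integral separated `W` of finite type over a field of characteristic
`p` and every purely inseparable `L/K(W)` of degree `p`, the pieces of `W^L` over the affine opens
of `W` admit resolutions compatible with restriction (a relative gluing datum of resolutions).
Each piece is the affine `p`-th-root model of the rank-5 item `PicoverLocalModel`; so rank 2 =
rank 5 + compatibility of the local resolutions under restriction of affine charts. [folklore] -/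
theorem picover_iff_functorialLocalResolutions :
    Summit.ResolutionOfSingularities.ResolutionOfSingularities.Theses.PAlteration.Picover ↔
    ∀ (p : ℕ), p.Prime → ∀ (k : Type) [Field k] [CharP k p] (W : Scheme.{0}) [IsIntegral W]
      (f : W ⟶ Spec (.of k)) (L : Type) [Field L] [Algebra W.functionField L],
      IsSeparated f → LocallyOfFiniteType f → QuasiCompact f → Scheme.IsRegular W →
      IsPurelyInseparable W.functionField L → Module.finrank W.functionField L = p →
      ∃ d : Scheme.Cover.RelativeGluingData
        (W.directedAffineCover.pullback₁ (normalizationInι W L)),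
        ∀ U, IsResolution (d.natTrans.app U) :=
  ⟨functorialLocalResolutions_of_picover, picover_of_functorialLocalResolutions⟩

/-- **`Picover` ⟺ local resolutions functorial under PRINCIPAL LOCALISATION only.** The same
equivalence over Mathlib's small affine Zariski site of `W` (affine opens, arrows the basic-open
inclusions `D(g) ⊆ U`; `Scheme.AffineZariskiSite.directedCover`, locally directed because two affine
opens are covered around each common point by opens basic in both): the crux holds iff for every
`(p, k, W, L)` of the residue the pieces `W^L ×_W U`, `U = Spec R ⊆ W` affine, carry resolutions
compatible with the restrictions to `W^L ×_W D(g)`, `g ∈ R` — i.e. a resolution of the affine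
`p`-th-root models `Spec (R[T]/(T^p - a))~` of rank 5 that commutes with `R → R[1/g]`. This is the
algebraic form in which an invariant-driven (canonical) resolution algorithm delivers its output.
[folklore; cite: StacksProject, Tag 01LH] -/
theorem picover_iff_functorialLocalResolutions_basicOpen : Summit.ResolutionOfSingularities.ResolutionOfSingularities.Theses.PAlteration.Picover ↔ ∀ (p : ℕ), p.Prime → ∀ (k : Type) [Field k] [CharP k p] (W : Scheme.{0}) [IsIntegral W] (f : W ⟶ Spec (.of k)) (L : Type) [Field L] [Algebra W.functionField L], IsSeparated f → LocallyOfFiniteType f → QuasiCompact f → Scheme.IsRegular W → IsPurelyInseparable W.functionField L → Module.finrank W.functionField L = p → ∃ d : Scheme.Cover.RelativeGluingData ((Scheme.AffineZariskiSite.directedCover W).pullback₁ (normalizationInι W L)), ∀ U, IsResolution (d.natTrans.app U) := by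
  refine ⟨fun h p hp k _ _ W _ f L _ _ hs hl hq hreg hpi hdeg => ?_, fun H => ?_⟩
  · obtain ⟨T, π, hπ⟩ := DegPOfPicover.picoverDegP_of_picover h p hp k W f L hs hl hq hreg hpi hdeg
    exact exists_relativeGluingData_of_isResolution π hπ
  · refine OfDegP.picover_of_picoverDegP fun p hp k _ _ W _ f L _ _ hs hl hq hreg hpi hdeg => ?_
    obtain ⟨d, hd⟩ := H p hp k W f L hs hl hq hreg hpi hdeg
    haveI : Quiver.IsThin
        ((Scheme.AffineZariskiSite.directedCover W).pullback₁ (normalizationInι W L)).I₀ :=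
      inferInstanceAs (Quiver.IsThin W.AffineZariskiSite)
    exact hasResolution_of_relativeGluingData d hd

end Summit.ResolutionOfSingularities.ResolutionOfSingularities.Theorems.Picover.ResolutionGluing
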